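import Summits.CriticalPhenomena.PercolationContinuityZ3.Theorems.Transplant.SkelNeg1RootHoldsLE
import Summits.CriticalPhenomena.PercolationContinuityZ3.Theorems.Transplant.SkelNegBParamsResidualsAK
import HarnessLib

/-!
# N1 (the `{±1}` node), (R) column at SLOT-LEDGER (ζ′) v3 (κ-dependent bridge index `cK κ := 1000·Kq κ + 1` inside the K-slots; located p5-g12
# 2026-08-22T09:17:13Z, ruled p3-g12 09:38:09Z, adopted lead 09:38:40Z, keeper stmt-g17 10:03:06Z `ResidualsAK`):
# **`rootHoldsNOWFnL_negChoiceAllOTA_FK (Px mx) : RootHoldsNOWFnL NegB.LfA (negChoiceAllOTA (KS.gT 0 KS.gxAK) (KS.fT 0 KS.fxA) (KS.PR 0 Px) (SUA exAFK mx))`**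
# — ONE LINE over the slot-robust wrapper `rootHoldsNOWFnL_negChoiceAllOTA_of_le` (SkelNeg1RootHoldsLE) with stmt-g17's ∀-form servers
# `NegB.HML_gxAK` (the two `M_L` floors at `gT 0 gxAK`) and `NegB.Hle_exAFK` (`exA ≤ exAFK` pointwise).  v1 (`SUA exA mx`, p322744) and v2
# (`SUA (exAF c) mx`, p324431) stay as landed intermediates.

builds on p205010 (kernel theorem, internal audit signed; external expert review pending) — nothing here uses it; NOTHING is claimed about the open node
`SamePDropOfSkeletonNeg₁`: this is ONE of the four hypotheses of `samePDropOfSkeletonNeg₁_of_choiceFnNOWL NegB.LfA (negChoiceAllOTA …)` at the v3 tuple.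
Lane `prim-bschramm`, seat `prim-bschramm-p3` (gen 12; design owner + (R) owner); helper file (`--supports stmt-CriticalPhenomena-4575 --as helper`).
[cite: KozmaNitzan2024, §4 p. 28 ((32) at the root)]
-/

noncomputable section

open scoped Classical

namespace Summit.CriticalPhenomena.PercolationContinuityZ3.Theorems.Transplant

namespace PlanarSkeletonNeg

set_option maxHeartbeats 1600000 in
/-- **`RootHoldsNOWFnL NegB.LfA` of the (ζ′) v3 choice function** (`gx := KS.gxAK`, `fx := KS.fxA`, `ex := exAFK`; any `Px mx`).
[cite: KozmaNitzan2024, §4 p. 28 ((32) at the root)] -/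
theorem rootHoldsNOWFnL_negChoiceAllOTA_FK (Px : NegB.PSlot) (mx : NegB.GSlot) :
    RootHoldsNOWFnL NegB.LfA
      (negChoiceAllOTA (NegB.KS.gT 0 NegB.KS.gxAK) (NegB.KS.fT 0 NegB.KS.fxA) (NegB.KS.PR 0 Px) (NegB.SUA NegB.exAFK mx)) :=
  rootHoldsNOWFnL_negChoiceAllOTA_of_le NegB.KS.gxAK Px NegB.exAFK mx NegB.HML_gxAK NegB.Hle_exAFK

end PlanarSkeletonNeg

end Summit.CriticalPhenomena.PercolationContinuityZ3.Theorems.Transplant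

end
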